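import Summits.MatrixMultiplication.MatrixMultiplication.Theorems.AbelianSTPPCensusTAStatQNode
import Summits.MatrixMultiplication.MatrixMultiplication.Theorems.AbelianSTPPCensusQuartet
import Summits.MatrixMultiplication.MatrixMultiplication.Theorems.AbelianSTPPCensusU11GPrimeTools

/-!
# Static t*-certificate under the quartet: the budget instantiation `bud = gwC`, `t0 = 2` from vM ∧ U11-G′ (and from `Quartet.QuartetAdm`)

Cell mm-stpp (rung F-M1), seat mm-stpp-vp-p2 (gen 8); census-silent kernel enabler (plan g20, HOME/STATUS 2026-08-28T22:53:43Z).  The re-issued machine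
(`AbelianSTPPCensusTAStatQ{Node,Tree,Sound}.lean`) reads the Grynkiewicz budget through the row fact `HypsQ.bud`: at every parameter `t ≥ t0` with a source member
(smallest size `< t ≤` its least pair product), `t·Σ_i p_i ≤ Σ_i V_i + t·M + bud t` (split at the maximal member).  This file supplies that fact for the QUARTET:
* `gw_budget_of_sorted` — from `SieveAdmissible M ∧ U11GPrime M` (theory g13's `U11GPrimeTools.gw_budget_A/B/C`, consumed BY NAME), for a source member `q` given in
  the sorted-form case format of the ranges' `exists_sorted` (`TD2Stat.budget_of_sorted` is the trio version: `U11G`, `t ≥ 3`, constant `2t²` with `+ 1`):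
  `t·Σ_i (a_i b_i + b_i c_i + c_i a_i) ≤ Σ_i a_i b_i c_i + t·M + gwC t` for `2 ≤ t`;
* `gw_budget_of_quartet` — the same from `Quartet.QuartetAdm M a b c` (theory g13, p667556), by its projections;
* `budget_split` — the bookkeeping identity turning the full-sum form into the `HypsQ.bud` form split at the maximal member `l`.
WHAT THIS IS NOT: arithmetic on the typed rules only — no STPP family, no certificate, no census number, no existence claim, no `ω`.
-/

set_option linter.dupNamespace false
set_option autoImplicit false

namespace Summit.MatrixMultiplication.MatrixMultiplication.Theorems.TAStatQ

open Finset

variable {N M : ℕ}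

/-- **The quartet's budget of a source member** (U11-G′ through `U11GPrimeTools.gw_budget_A/B/C`): if the list is `SieveAdmissible M` and `U11GPrime M`, and the member `q` —
read in sorted form `y` (`y.1` its smallest size, `y.2.1` the smaller of the other two, in one of the three letter positions) — has `y.1 < t ≤ y.1·y.2.1` with `2 ≤ t`, then
`t·Σ_i (a_i b_i + b_i c_i + c_i a_i) ≤ Σ_i a_i b_i c_i + t·M + gwC t`. [original] -/
theorem gw_budget_of_sorted {a b c : Fin N → ℕ} (hS : SieveAdmissible M a b c) (hG : U11GPrime M a b c) (q : Fin N)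
    {y : ℕ × ℕ × ℕ} {t : ℕ}
    (hcs : (y.1 = a q ∧ y.2.1 = min (c q) (b q) ∧ a q ≤ c q ∧ a q ≤ b q) ∨ (y.1 = b q ∧ y.2.1 = min (a q) (c q) ∧ b q ≤ a q ∧ b q ≤ c q) ∨
      (y.1 = c q ∧ y.2.1 = min (b q) (a q) ∧ c q ≤ b q ∧ c q ≤ a q))
    (h1 : y.1 < t) (h2 : t ≤ y.1 * y.2.1) (h3 : 2 ≤ t) :
    t * (∑ i, (a i * b i + b i * c i + c i * a i)) ≤ (∑ i, a i * b i * c i) + t * M + gwC t := by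
  unfold gwC
  rcases hcs with ⟨hy1, hy2, -, -⟩ | ⟨hy1, hy2, -, -⟩ | ⟨hy1, hy2, -, -⟩
  · exact U11GPrimeTools.gw_budget_A hS hG q (by rw [← hy1]; exact h1) (by rw [← hy1, ← hy2]; exact h2) h3
  · exact U11GPrimeTools.gw_budget_B hS hG q (by rw [← hy1]; exact h1) (by rw [← hy1, ← hy2]; exact h2) h3
  · exact U11GPrimeTools.gw_budget_C hS hG q (by rw [← hy1]; exact h1) (by rw [← hy1, ← hy2]; exact h2) h3

/-- **The quartet's budget of a source member**, from `Quartet.QuartetAdm` (vM ∧ U11-G′ ∧ E3 ∧ U11-F2; only the first two conjuncts are read). [original] -/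
theorem gw_budget_of_quartet {a b c : Fin N → ℕ} (hQ : Quartet.QuartetAdm M a b c) (q : Fin N)
    {y : ℕ × ℕ × ℕ} {t : ℕ}
    (hcs : (y.1 = a q ∧ y.2.1 = min (c q) (b q) ∧ a q ≤ c q ∧ a q ≤ b q) ∨ (y.1 = b q ∧ y.2.1 = min (a q) (c q) ∧ b q ≤ a q ∧ b q ≤ c q) ∨
      (y.1 = c q ∧ y.2.1 = min (b q) (a q) ∧ c q ≤ b q ∧ c q ≤ a q))
    (h1 : y.1 < t) (h2 : t ≤ y.1 * y.2.1) (h3 : 2 ≤ t) :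
    t * (∑ i, (a i * b i + b i * c i + c i * a i)) ≤ (∑ i, a i * b i * c i) + t * M + gwC t :=
  gw_budget_of_sorted hQ.1 hQ.2.1 q hcs h1 h2 h3

/-- the smallest size of a member in sorted form is below `t` as soon as `t` exceeds EVERY size bound `s` with `a_q, b_q, c_q ≤ s` — the thin-regime reading of the
rule (theory g14: at the walls of record the killing parameter lies above every size). [bookkeeping] -/
theorem sorted_fst_lt_of_sizes_le {a b c : Fin N → ℕ} (q : Fin N) {y : ℕ × ℕ × ℕ} {s t : ℕ}
    (hcs : (y.1 = a q ∧ y.2.1 = min (c q) (b q) ∧ a q ≤ c q ∧ a q ≤ b q) ∨ (y.1 = b q ∧ y.2.1 = min (a q) (c q) ∧ b q ≤ a q ∧ b q ≤ c q) ∨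
      (y.1 = c q ∧ y.2.1 = min (b q) (a q) ∧ c q ≤ b q ∧ c q ≤ a q))
    (ha : a q ≤ s) (hb : b q ≤ s) (hc : c q ≤ s) (hst : s < t) : y.1 < t := by
  rcases hcs with ⟨hy1, -, -, -⟩ | ⟨hy1, -, -, -⟩ | ⟨hy1, -, -, -⟩ <;> omega

/-- **Splitting the budget at the maximal member** (the `HypsQ.bud` form): `t·Σ_i p_i ≤ Σ_i V_i + t·M + B` is
`t·(Σ_{q≠l} p_q + p_l) ≤ (Σ_{q≠l} V_q + V_l) + t·M + B`. [bookkeeping] -/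
theorem budget_split (l : Fin N) (pq Vq : Fin N → ℕ) {t B : ℕ}
    (h : t * (∑ i, pq i) ≤ (∑ i, Vq i) + t * M + B) :
    t * ((∑ q ∈ Finset.univ.erase l, pq q) + pq l) ≤ ((∑ q ∈ Finset.univ.erase l, Vq q) + Vq l) + t * M + B := by
  classical
  have e1 : (∑ q ∈ Finset.univ.erase l, pq q) + pq l = ∑ i, pq i := Finset.sum_erase_add _ _ (Finset.mem_univ l)
  have e2 : (∑ q ∈ Finset.univ.erase l, Vq q) + Vq l = ∑ i, Vq i := Finset.sum_erase_add _ _ (Finset.mem_univ l)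
  rw [e1, e2]; exact h

/-- **The quartet's row fact `HypsQ.bud`, assembled**: under `SieveAdmissible M ∧ U11GPrime M`, with every member read in sorted form (`ysh`, in the case format, smallest
size `mn q = (ysh q).1`, least pair product `tq q = (ysh q).1 · (ysh q).2.1`), the budget holds at every `t ≥ 2` that has a source member, split at any member `l`. [original] -/
theorem hypsQ_bud_of_u11GPrime {a b c : Fin N → ℕ} (hS : SieveAdmissible M a b c) (hG : U11GPrime M a b c) (l : Fin N)
    (ysh : Fin N → ℕ × ℕ × ℕ)
    (hcs : ∀ q, ((ysh q).1 = a q ∧ (ysh q).2.1 = min (c q) (b q) ∧ a q ≤ c q ∧ a q ≤ b q) ∨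
      ((ysh q).1 = b q ∧ (ysh q).2.1 = min (a q) (c q) ∧ b q ≤ a q ∧ b q ≤ c q) ∨
      ((ysh q).1 = c q ∧ (ysh q).2.1 = min (b q) (a q) ∧ c q ≤ b q ∧ c q ≤ a q)) :
    ∀ t, 2 ≤ t → (∃ q, (ysh q).1 < t ∧ t ≤ (ysh q).1 * (ysh q).2.1) →
      t * ((∑ q ∈ Finset.univ.erase l, (a q * b q + b q * c q + c q * a q)) + (a l * b l + b l * c l + c l * a l)) ≤
        ((∑ q ∈ Finset.univ.erase l, a q * b q * c q) + a l * b l * c l) + t * M + gwC t := by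
  intro t ht2 ⟨q, hq1, hq2⟩
  exact budget_split (M := M) l (fun i => a i * b i + b i * c i + c i * a i) (fun i => a i * b i * c i)
    (gw_budget_of_sorted hS hG q (hcs q) hq1 hq2 ht2)

end Summit.MatrixMultiplication.MatrixMultiplication.Theorems.TAStatQ
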